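/-
Copyright (c) 2026 the pub-hodgecm-mathlib formalisation cell (harness21).  Prover seat hodgecm-mathlib-F0P3a-p06-g25 (EP-PAIRS hand, RIDER 2b; LEAD F0P3a-plan (g16) T15-24 (3)∕T15-25 (c);
G-row dealer F0P3a-p09 (g14); box LH10-p02 (g13)); 2026-09-03.
-/
import Summits.HodgeConjecture.HodgeConjecture.Theorems.F0P3cStCharTSEPPairs              -- FILE G (this seat): `isEllipticPairEP_datum` (explicit level letters)
import Summits.HodgeConjecture.HodgeConjecture.Theorems.F0P3cStCharTSPctOut              -- ★ PCT-OUT `pseudoCoeffTrace_Gqs`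
import Summits.HodgeConjecture.HodgeConjecture.Theorems.F0P3cStCharTSEPPseudoCoeffStUnr  -- ★ (G5) C (F0P3-p02): `charOpposite_stG_detG_of_PS2`
import HarnessLib

/-!
# F0 · P3c · line LH6 «StCharTS» — RIDER 2b «EP-PAIRS», FILE H: THE JUNCTION-FACING HEAD `isEllipticPair_of_epFamily` AT AN UNRAMIFIED NON-SPLIT `v`
# (level data `w hw ϖ hd g₁ eA K₀ K₁ I f_EP` OBTAINED INSIDE from `hunr`, LEAD T15-24 (3); place token = `Algebra.IsUnramifiedIn (𝓞 L) v.asIdeal` ALONE, T15-25 (c) left branch)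

Cell `pub/hodgecm-mathlib` (D-0151), FLOOR 0, crux item H413 = `stmt-HodgeConjecture-24833` (`--supports` lane, helper; seat F0P3a-p06 (g25)).  THEOREMS ONLY.  Binders ⊆ the junction's
letters: `L v hns hunr νQv mQv hcanQ 𝔇`, COMPAT `hμG horb hreg`, the pin `hE`, (M1∀) `hM1`, the carpet relations `hWIF hC1 hC2 hC3 hL2` (★ PCT-OUT's own), the ST-PIN letters
`ι hιc hι detZ hdetZ μZ` with the per-`ψ` clauses `hdet hne hJH hStL2 hDet` as functions of `ψ` (fields `𝔇.stG 𝔇.detG`), and `hOpp` (§1) or ★ OPP-23's sockets `hopen' par hPS2 hNP` with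
the pin's `h𝔇` clauses `hStIsL2 hDetNotL2` (§2).  HONEST LABEL: count-neutral (this is the `hEP` binder of ★ `prop1261bNs_of_cases` at the datum; organs 2 = 2; closes no node by itself);
HC_CM is proved only modulo the 7 printed citations (hLiu418 = stmt-HodgeConjecture-24832, h413 = stmt-HodgeConjecture-24833) until rung 0 closes.

MATHEMATICS [Rogawski1990 §12.6 Prop. 12.6.1 (b) p. 188; Kottwitz1988 §2].  As ★ (G3) §1: a place `w ∣ v`, the unramified datum `(ϖ, hd)` (★ `unramifiedLocalConjDatum_adicCompletion`), the
edge matrix `g₁ = diag(1,1,ϖ)`, the one-place model `eA` (★ `localNonsplitEquiv` re-read on `Φ₃ = antidiag(1,1,1)`), the levels and Kottwitz's `f_EP` by `rfl`; then ★ (G3)-EXPLICIT's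
clauses 1∕7∕8, ★ PCT-OUT, and FILE G's `isEllipticPairEP_datum`.

## References
* [Rogawski1990] J. D. Rogawski, *Automorphic Representations of Unitary Groups in Three Variables*, Ann. of Math. Stud. 123 (1990), §12.6 Prop. 12.6.1 (b)(c) p. 188; §12.5 p. 184.
* [Kottwitz1988] R. E. Kottwitz, *Tamagawa numbers*, Ann. of Math. 127 (1988), §2 Theorem 2.
-/

set_option autoImplicit false
-- the mandated namespace has the single-problem summit's repeated segment (`HodgeConjecture.HodgeConjecture`)
set_option linter.dupNamespace false

noncomputable section

open NumberField IsDedekindDomain MeasureTheory Topology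
open scoped Matrix MatrixGroups Valued
open Literature.NumberTheory.Rogawski1990 Literature.NumberTheory.Rogawski1990.Ch12Sec5
open Literature.NumberTheory.Automorphic Literature.NumberTheory.Automorphic.UnitaryGroup Literature.NumberTheory.GaloisRepresentations
open Summit.HodgeConjecture.HodgeConjecture.Cruxes.H413.F0P3cStCharTSTorusDefs

namespace Summit.HodgeConjecture.HodgeConjecture.Cruxes.H413.F0P3cStCharTSEPPairsDatum

open Summit.HodgeConjecture.HodgeConjecture.Cruxes.H413
open Summit.HodgeConjecture.HodgeConjecture.Cruxes.H413.F0P3cStCharTSEPGlueGExplicit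
open Summit.HodgeConjecture.HodgeConjecture.Cruxes.H413.F0P3cStCharTSEPPairs
open Summit.HodgeConjecture.HodgeConjecture.Cruxes.H413.F0P3cStCharTSEPPseudoCoeffStUnr (charOpposite_stG_detG_of_PS2)

variable (L : Type) [Field L] [NumberField L] [IsCMField L] (v : HeightOneSpectrum (𝓞 ↥(maximalRealSubfield L)))

/-! ## §1 `isEllipticPair_of_epFamily` (with `hOpp` as a binder-function) -/

set_option maxHeartbeats 1600000 in
set_option synthInstance.maxHeartbeats 400000 in
-- instance-path unification between `Gqs L v` and the literal carrier of ★ `cmPrincipalSeries`; statement-level `whnf` on the CM carriers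
/-- **RIDER 2b «EP-PAIRS» — THE EP-FAMILY INSTANCE OF PROP. 12.6.1 (b) AT A §12.5 DATUM ON `U(Φ₃)(L⁺_v)`, `v` NON-SPLIT AND UNRAMIFIED IN `L`.**  If `π, π′ ∈ {St_G(ψ), ψ∘det_G :
ψ continuous}`, `⟨χ_π, χ_{π′}⟩_e ≠ 0` and `π ≠ π′`, then `𝔇.IsEllipticPair π π′`.  The place `w`, the unramified datum, the edge matrix, the one-place model, the three levels and
Kottwitz's `f_EP` are obtained INSIDE (★ (G3) §1 verbatim); then ★ (G3)-EXPLICIT `epFunction_G_explicit` (clauses 1∕7∕8), ★ PCT-OUT `pseudoCoeffTrace_Gqs` and FILE G `isEllipticPairEP_datum`.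
This is the `hEP` binder of ★ `F0P3cStCharTSP1261bOfCases.prop1261bNs_of_cases 𝔇 hEP hRest` under the guard's place token `Algebra.IsUnramifiedIn (𝓞 L) v.asIdeal`.
[cite: Rogawski1990, §12.6 Prop. 12.6.1 (b) p. 188; §12.5 p. 184] [cite: Kottwitz1988, §2 Theorem 2] -/
theorem isEllipticPair_of_epFamily (hns : ∀ w : PlacesOver L v, IsCMField.complexConj L • w.1 = w.1)
    (hunr : Algebra.IsUnramifiedIn (𝓞 L) v.asIdeal)
    [MeasurableSpace (Gqs L v)] [BorelSpace (Gqs L v)]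
    [∀ γ : Gqs L v, MeasurableSpace (Gqs L v ⧸ Subgroup.centralizer ({γ} : Set (Gqs L v)))]
    [∀ γ : Gqs L v, BorelSpace (Gqs L v ⧸ Subgroup.centralizer ({γ} : Set (Gqs L v)))]
    [MeasurableSpace (Gqs L v ⧸ Subgroup.center (Gqs L v))]
    {H : Type} [Group H] [TopologicalSpace H] [IsTopologicalGroup H] [MeasurableSpace H]
    (νQv : Measure (Gqs L v)) [νQv.IsHaarMeasure] [νQv.IsMulRightInvariant]
    {mQv : OrbitalMeasureFamily (Gqs L v)}
    (hcanQ : mQv.IsCanonical (fun γ => IsRegularElt (γ.val : GL (Fin 3) (UnitaryGroup.LocalRing L v))) νQv)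
    (𝔇 : EllipticData (Gqs L v) H)
    (hμG : 𝔇.μG = νQv) (horb : 𝔇.orb = mQv)
    (hreg : ∀ γ : Gqs L v, γ ∈ 𝔇.regG ↔ IsRegularElt (γ.val : GL (Fin 3) (UnitaryGroup.LocalRing L v)))
    (hE : ∀ γ : Gqs L v, γ ∈ 𝔇.ellG ↔ IsRegularElt (γ.val : GL (Fin 3) (UnitaryGroup.LocalRing L v)) ∧ γ ∉ hyperbolicSet L v)
    (hM1 : ∀ π : IrrClass (Gqs L v), Measurable (𝔇.char π) ∧ LocallyIntegrable (𝔇.char π) 𝔇.μG ∧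
      (∀ x ∈ 𝔇.regG, ∀ᶠ y in 𝓝 x, 𝔇.char π y = 𝔇.char π x) ∧
      ∀ φ : Gqs L v → ℂ, IsLocSmooth φ → π.smoothTrace 𝔇.μG φ = ∫ x, φ x * 𝔇.char π x ∂𝔇.μG)
    (hWIF : 𝔇.WeylIntegrationFormula) (hC1 : 𝔇.EllCartanSubset) (hC2 : 𝔇.EllCartanAE) (hC3 : 𝔇.NonEllCartanAE) (hL2 : 𝔇.L2CharOnTorusAll)
    (ι : ↥(normOneUnits (conjLocal L (IsCMField.complexConj L) v)) →* ↥(Subgroup.center (Gqs L v))) (hιc : Continuous ι)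
    (hι : ∀ z : ↥(normOneUnits (conjLocal L (IsCMField.complexConj L) v)),
      ((ι z).val.val.val : Matrix (Fin 3) (Fin 3) (LocalRing L v)) = (((z : (LocalRing L v)ˣ) : LocalRing L v)) • (1 : Matrix (Fin 3) (Fin 3) (LocalRing L v)))
    (detZ : Gqs L v →* ↥(Subgroup.center (Gqs L v)))
    (hdetZ : ∀ g : Gqs L v, ((detZ g).val.val.val : Matrix (Fin 3) (Fin 3) (LocalRing L v)) =
        (g.val.val : Matrix (Fin 3) (Fin 3) (LocalRing L v)).det • (1 : Matrix (Fin 3) (Fin 3) (LocalRing L v)))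
    (μZ : Measure (Gqs L v ⧸ Subgroup.center (Gqs L v)))
    (hdet : ∀ ψ : ↥(Subgroup.center (Gqs L v)) →* ℂˣ, Continuous ψ →
      ∃ hopen : IsOpen (((ψ.comp detZ).ker : Subgroup (Gqs L v)) : Set (Gqs L v)), 𝔇.detG ψ = IrrClass.mk (SmoothIrrep.ofChar (ψ.comp detZ) hopen))
    (hne : ∀ ψ : ↥(Subgroup.center (Gqs L v)) →* ℂˣ, Continuous ψ → 𝔇.stG ψ ≠ 𝔇.detG ψ)
    (hJH : ∀ ψ : ↥(Subgroup.center (Gqs L v)) →* ℂˣ, Continuous ψ → ∀ c : IrrClass (Gqs L v),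
      c.IsConstituentOf (cmPrincipalSeries L 3 v
        (cmTorusCharPair L v (halfModulusChar (LocalRing L v) * halfModulusChar (LocalRing L v))⁻¹ (ψ.comp ι))) ↔ (c = 𝔇.stG ψ ∨ c = 𝔇.detG ψ))
    (hStL2 : ∀ ψ : ↥(Subgroup.center (Gqs L v)) →* ℂˣ, Continuous ψ → (𝔇.stG ψ).IsSquareIntegrable μZ)
    (hDet : ∀ ψ : ↥(Subgroup.center (Gqs L v)) →* ℂˣ, Continuous ψ → ¬ (𝔇.detG ψ).IsSquareIntegrable μZ)
    (hOpp : ∀ ψ : ↥(Subgroup.center (Gqs L v)) →* ℂˣ, Continuous ψ → ∀ γ ∈ 𝔇.ellG, 𝔇.char (𝔇.stG ψ) γ = -𝔇.char (𝔇.detG ψ) γ) :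
    ∀ π π' : IrrClass (Gqs L v),
      (∃ ψ : ↥(Subgroup.center (Gqs L v)) →* ℂˣ, Continuous ψ ∧ (π = 𝔇.stG ψ ∨ π = 𝔇.detG ψ)) →
      (∃ ψ' : ↥(Subgroup.center (Gqs L v)) →* ℂˣ, Continuous ψ' ∧ (π' = 𝔇.stG ψ' ∨ π' = 𝔇.detG ψ')) →
      𝔇.innerG (𝔇.char π) (𝔇.char π') ≠ 0 → π ≠ π' → 𝔇.IsEllipticPair π π' := by
  classical
  obtain ⟨w⟩ : Nonempty (PlacesOver L v) := inferInstance
  have hw : IsCMField.complexConj L • w.1 = w.1 := hns w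
  have hc1 : IsCMField.complexConj L ≠ 1 := IsCMField.complexConj_ne_one L
  haveI : Algebra.IsQuadraticExtension ↥(maximalRealSubfield L) L := IsCMField.isQuadraticExtension L
  -- the unramified datum at `w`, the edge matrix, the one-place model on `Φ₃ = antidiag(1,1,1)` (★ (G3) §1 verbatim)
  obtain ⟨ϖ, hd⟩ := unramifiedLocalConjDatum_adicCompletion (IsCMField.complexConj L) hc1 v w hw hunr
  have hϖ0 : ϖ ≠ 0 := fun h0 => by have hv := hd.vϖ; rw [h0, map_zero] at hv; exact WithZero.zero_ne_coe hv
  set g₁ : GL (Fin 3) (w.1.adicCompletion L) := glDiagonal 3 (w.1.adicCompletion L) ![1, 1, Units.mk0 ϖ hϖ0] with hg₁def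
  have hg₁ : (g₁ : Matrix (Fin 3) (Fin 3) (w.1.adicCompletion L)) = Matrix.diagonal ![(1 : w.1.adicCompletion L), 1, ϖ] := by
    rw [hg₁def, coe_glDiagonal]
    congr 1
    funext i
    fin_cases i <;> rfl
  have hJw : placeForm (qsForm L) w.1 = (StdForm.antidiagonal 3).over (w.1.adicCompletion L) := by
    rw [placeForm, qsForm, antidiagOne_eq_over, StdForm.over_map]
  obtain ⟨eA, heA⟩ : ∃ eA : Gqs L v ≃ₜ* ↥(unitaryGroupOfForm (galAdicCompletionMap (L := L) (IsCMField.complexConj L) hw) ((StdForm.antidiagonal 3).over (w.1.adicCompletion L))),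
      ∀ g : Gqs L v, ((eA g : ↥(unitaryGroupOfForm (galAdicCompletionMap (L := L) (IsCMField.complexConj L) hw) ((StdForm.antidiagonal 3).over (w.1.adicCompletion L)))) :
          GL (Fin 3) (w.1.adicCompletion L)) =
        ((localNonsplitEquiv (IsCMField.complexConj L) (qsForm L) (IsCMField.complexConj_ne_one L) w hw g :
          ↥(unitaryGroupOfForm (galAdicCompletionMap (L := L) (IsCMField.complexConj L) hw) (placeForm (qsForm L) w.1))) : GL (Fin 3) (w.1.adicCompletion L)) := by
    rw [← hJw]
    exact ⟨localNonsplitEquiv (IsCMField.complexConj L) (qsForm L) (IsCMField.complexConj_ne_one L) w hw, fun g => rfl⟩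
  -- ★ (G3)-EXPLICIT: clauses 1∕7∕8 for the displayed `f_EP` on the levels `K₀ K₁ I` (all `rfl`)
  obtain ⟨hfGs, -, -, -, -, -, h1, h0⟩ := epFunction_G_explicit L v hns hunr w hw hd g₁ hg₁ eA heA _ _ _ rfl rfl rfl νQv hcanQ _ rfl
  -- ★ PCT-OUT
  have hPCT := F0P3cStCharTSPctOut.pseudoCoeffTrace_Gqs L v hns νQv 𝔇 hμG hreg hM1 hWIF hC1 hC2 hC3 hL2
  exact isEllipticPairEP_datum L v w hw eA heA hns hd g₁ hg₁ _ _ _ rfl rfl rfl νQv _ rfl ι hιc hι detZ hdetZ μZ mQv 𝔇 hμG horb hreg hE hM1 hPCT hfGs h1 h0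
    hdet hne hJH hStL2 hDet hOpp

/-! ## §2 `isEllipticPair_of_epFamily_of_PS2` (`hOpp` discharged by ★ OPP-23's sockets, as in ★ (G5) C `epFamily_letters_of_epFunction_of_PS2`) -/

set_option maxHeartbeats 1600000 in
set_option synthInstance.maxHeartbeats 400000 in
-- instance-path unification between `Gqs L v` and the literal carrier of ★ `cmPrincipalSeries`; statement-level `whnf` on the CM carriers
/-- **§1 with `hOpp` discharged**: the opposite-character relation `χ_{St_G(ψ)} = −χ_{ψ∘det_G}` on `G^e` is ★ (G5) C `charOpposite_stG_detG_of_PS2` (★ OPP-23 at the kind-2 pair) from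
ELL-OPEN `hopen'`, the pair sockets (PS2) `hPS2` ∕ (NONL2-PAR) `hNP` with the parameter map `par`, and the pin's `h𝔇` clauses `hStIsL2 : ∀ ψ, 𝔇.IsL2 (St_G ψ)`, `hDetNotL2 : 𝔇.DetNotL2`.
[cite: Rogawski1990, §12.6 Prop. 12.6.1 (b)(c) p. 188; §12.7 L. 12.7.2 (proof) p. 192] [cite: Kottwitz1988, §2 Theorem 2] -/
theorem isEllipticPair_of_epFamily_of_PS2 (hns : ∀ w : PlacesOver L v, IsCMField.complexConj L • w.1 = w.1)
    (hunr : Algebra.IsUnramifiedIn (𝓞 L) v.asIdeal)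
    [MeasurableSpace (Gqs L v)] [BorelSpace (Gqs L v)]
    [∀ γ : Gqs L v, MeasurableSpace (Gqs L v ⧸ Subgroup.centralizer ({γ} : Set (Gqs L v)))]
    [∀ γ : Gqs L v, BorelSpace (Gqs L v ⧸ Subgroup.centralizer ({γ} : Set (Gqs L v)))]
    [MeasurableSpace (Gqs L v ⧸ Subgroup.center (Gqs L v))]
    {H : Type} [Group H] [TopologicalSpace H] [IsTopologicalGroup H] [MeasurableSpace H]
    (νQv : Measure (Gqs L v)) [νQv.IsHaarMeasure] [νQv.IsMulRightInvariant]
    {mQv : OrbitalMeasureFamily (Gqs L v)}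
    (hcanQ : mQv.IsCanonical (fun γ => IsRegularElt (γ.val : GL (Fin 3) (UnitaryGroup.LocalRing L v))) νQv)
    (𝔇 : EllipticData (Gqs L v) H)
    (hμG : 𝔇.μG = νQv) (horb : 𝔇.orb = mQv)
    (hreg : ∀ γ : Gqs L v, γ ∈ 𝔇.regG ↔ IsRegularElt (γ.val : GL (Fin 3) (UnitaryGroup.LocalRing L v)))
    (hE : ∀ γ : Gqs L v, γ ∈ 𝔇.ellG ↔ IsRegularElt (γ.val : GL (Fin 3) (UnitaryGroup.LocalRing L v)) ∧ γ ∉ hyperbolicSet L v)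
    (hopen' : IsOpen {g : Gqs L v | IsRegularElt (g.val : GL (Fin 3) (UnitaryGroup.LocalRing L v)) ∧ g ∉ hyperbolicSet L v})
    (hM1 : ∀ π : IrrClass (Gqs L v), Measurable (𝔇.char π) ∧ LocallyIntegrable (𝔇.char π) 𝔇.μG ∧
      (∀ x ∈ 𝔇.regG, ∀ᶠ y in 𝓝 x, 𝔇.char π y = 𝔇.char π x) ∧
      ∀ φ : Gqs L v → ℂ, IsLocSmooth φ → π.smoothTrace 𝔇.μG φ = ∫ x, φ x * 𝔇.char π x ∂𝔇.μG)
    (hWIF : 𝔇.WeylIntegrationFormula) (hC1 : 𝔇.EllCartanSubset) (hC2 : 𝔇.EllCartanAE) (hC3 : 𝔇.NonEllCartanAE) (hL2 : 𝔇.L2CharOnTorusAll)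
    (par : IrrClass (Gqs L v) → (((UnitaryGroup.LocalRing L v)ˣ →* ℂˣ) × (↥(normOneUnits (conjLocal L (IsCMField.complexConj L) v)) →* ℂˣ)))
    (hPS2 : ∀ π σ : IrrClass (Gqs L v), ¬ 𝔇.IsL2 π → 𝔇.IsL2 σ → 𝔇.IsEllipticPair π σ → ∀ f : Gqs L v → ℂ, IsLocSmooth f →
        π.smoothTrace νQv f + σ.smoothTrace νQv f =
          Representation.smoothTrace (G := Gqs L v) (UnitaryGroup.cmPrincipalSeries L 3 v (UnitaryGroup.cmTorusCharPair L v (par π).1 (par π).2)) νQv f)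
    (hNP : ∀ π : IrrClass (Gqs L v), ¬ 𝔇.IsL2 π →
        π.IsConstituentOf (UnitaryGroup.cmPrincipalSeries L 3 v (UnitaryGroup.cmTorusCharPair L v (par π).1 (par π).2)) ∧
          Continuous (par π).1 ∧ Continuous (par π).2)
    (ι : ↥(normOneUnits (conjLocal L (IsCMField.complexConj L) v)) →* ↥(Subgroup.center (Gqs L v))) (hιc : Continuous ι)
    (hι : ∀ z : ↥(normOneUnits (conjLocal L (IsCMField.complexConj L) v)),
      ((ι z).val.val.val : Matrix (Fin 3) (Fin 3) (LocalRing L v)) = (((z : (LocalRing L v)ˣ) : LocalRing L v)) • (1 : Matrix (Fin 3) (Fin 3) (LocalRing L v)))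
    (detZ : Gqs L v →* ↥(Subgroup.center (Gqs L v)))
    (hdetZ : ∀ g : Gqs L v, ((detZ g).val.val.val : Matrix (Fin 3) (Fin 3) (LocalRing L v)) =
        (g.val.val : Matrix (Fin 3) (Fin 3) (LocalRing L v)).det • (1 : Matrix (Fin 3) (Fin 3) (LocalRing L v)))
    (μZ : Measure (Gqs L v ⧸ Subgroup.center (Gqs L v)))
    (hdet : ∀ ψ : ↥(Subgroup.center (Gqs L v)) →* ℂˣ, Continuous ψ →
      ∃ hopen : IsOpen (((ψ.comp detZ).ker : Subgroup (Gqs L v)) : Set (Gqs L v)), 𝔇.detG ψ = IrrClass.mk (SmoothIrrep.ofChar (ψ.comp detZ) hopen))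
    (hne : ∀ ψ : ↥(Subgroup.center (Gqs L v)) →* ℂˣ, Continuous ψ → 𝔇.stG ψ ≠ 𝔇.detG ψ)
    (hJH : ∀ ψ : ↥(Subgroup.center (Gqs L v)) →* ℂˣ, Continuous ψ → ∀ c : IrrClass (Gqs L v),
      c.IsConstituentOf (cmPrincipalSeries L 3 v
        (cmTorusCharPair L v (halfModulusChar (LocalRing L v) * halfModulusChar (LocalRing L v))⁻¹ (ψ.comp ι))) ↔ (c = 𝔇.stG ψ ∨ c = 𝔇.detG ψ))
    (hStL2 : ∀ ψ : ↥(Subgroup.center (Gqs L v)) →* ℂˣ, Continuous ψ → (𝔇.stG ψ).IsSquareIntegrable μZ)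
    (hDet : ∀ ψ : ↥(Subgroup.center (Gqs L v)) →* ℂˣ, Continuous ψ → ¬ (𝔇.detG ψ).IsSquareIntegrable μZ)
    (hStIsL2 : ∀ ψ : ↥(Subgroup.center (Gqs L v)) →* ℂˣ, Continuous ψ → 𝔇.IsL2 (𝔇.stG ψ)) (hDetNotL2 : 𝔇.DetNotL2) :
    ∀ π π' : IrrClass (Gqs L v),
      (∃ ψ : ↥(Subgroup.center (Gqs L v)) →* ℂˣ, Continuous ψ ∧ (π = 𝔇.stG ψ ∨ π = 𝔇.detG ψ)) →
      (∃ ψ' : ↥(Subgroup.center (Gqs L v)) →* ℂˣ, Continuous ψ' ∧ (π' = 𝔇.stG ψ' ∨ π' = 𝔇.detG ψ')) →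
      𝔇.innerG (𝔇.char π) (𝔇.char π') ≠ 0 → π ≠ π' → 𝔇.IsEllipticPair π π' :=
  isEllipticPair_of_epFamily L v hns hunr νQv hcanQ 𝔇 hμG horb hreg hE hM1 hWIF hC1 hC2 hC3 hL2 ι hιc hι detZ hdetZ μZ hdet hne hJH hStL2 hDet
    (fun ψ hψ => charOpposite_stG_detG_of_PS2 L v hns νQv mQv hcanQ 𝔇 hμG hreg (fun γ hγ => (hE γ).1 hγ) hopen' hM1 par hPS2 hNP hψ
      (hDetNotL2 ψ hψ) (hStIsL2 ψ hψ))

end Summit.HodgeConjecture.HodgeConjecture.Cruxes.H413.F0P3cStCharTSEPPairsDatum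

end
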